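import Summits.BirchSwinnertonDyer.Rank1Residual.Additive.RamifiedSevenGenusTowerLifts
import Summits.BirchSwinnertonDyer.Rank1Residual.Additive.RamifiedSevenMemberRealisation
import Literature.NumberTheory.IwasawaTheory.IwasawaAlgebraProjectiveLimit
import Literature.NumberTheory.IwasawaTheory.KubotaLeopoldtPowerSeries
import Literature.NumberTheory.EllipticCurves.Kato2004.KummerFrameOfTorsionTower
import Literature.NumberTheory.Congruences.BernoulliTeichmullerCongruence
import Literature.NumberTheory.GaussSums.JacobiSumTeichmullerIntegralQuadratic
import Literature.NumberTheory.QuadraticFields.JacobiCharacterInt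
import Literature.NumberTheory.QuadraticFields.JacobiCharacterPrimitiveProofs
import Literature.NumberTheory.EllipticCurves.Kato2004.LayerCharacterTwoProofs
import Mathlib.NumberTheory.GaussSum
import Mathlib.NumberTheory.Padics.HeightOneSpectrum
import HarnessLib

/-!
# K2C-14 — the ARITHMETIC INPUTS of a `𝒞₇` genus frame (`GenusSeven.GenusFrame`), DRAFT-OF-RECORD

DRAFT-OF-RECORD for row K2C-14 (pen D1048); port target
`Summits/BirchSwinnertonDyer/Rank1Residual/Additive/GenusFrameArithmeticInputs.lean`; tree files never import `Cruxes/`.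

Cell bsd-cm, seat bsd-idea-20 g77 (planner, crux-level, W-79 publish-only), crux `EllipticUnitValueSevenOfGZK`
(stmt-BirchSwinnertonDyer-19945, route K7r `RamifiedSevenEllipticUnits`).  Specification = the K2C-11 inventory memo v3
`Cruxes/EllipticUnitValueSevenOfGZK/K2C11ConstructionInventory_g76.md` (tree 12ee9b0d407224ef) §1(b)/(c); row card
`pub/bsd-cm/bsd-cm-plan/g37/SUMMON-typers-K2C-13-16.md` (7e0dfdb9162e356c); pen rulings D1044 (C), D1045, D1048.

WHAT THIS FILE DOES.  For a discriminant `D` (`D < 0`, `D ≡ 1 (mod 4)`, squarefree, `7 ∤ D`) it CONSTRUCTS / PROVES, one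
declaration per field and in the EXACT letter of the field (`RamifiedSevenGenusFactorisationShape.lean` l.101–157), every
field of `GenusSeven.GenusFrame` between `v` (l.113) and `r_logTable` (l.154) — i.e. everything except the road data
`D, normA` (parameters) and the semi-local datum `U` (l.156–157, row K2C-13 ★).  PORT: change the `namespace` line to
`Summit.BirchSwinnertonDyer.Rank1Residual.Additive.GenusSeven.ArithmeticInputs` and the path; nothing else.

§A GENERIC KERNELS (odd `p`; the three template-less ones of the memo first):
* (A1) `exists_pow_sub_mem_span_pow_of_isTopGenerator` — the powers of a topological generator `u` of `1 + pℤ_p`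
  exhaust the principal units modulo `p^{n+1}`; (A2) `exists_isLogTable` — a `γ`-log table EXISTS for every such `u`
  and every Teichmüller `ω` (`IsLogTable p u ω r`, Lang Ch. 10 §1);
* (A3) `coeffSubring_ringHomComp_intAlgebraMap`, `exists_map_intAlgebraMap_eq` — the `ℤ_p`-descent of an integral
  Kubota–Leopoldt series of a `ℤ_p`-VALUED character; (A4) `exists_int_kubotaLeopoldtSeries` (under the displayed
  named fact `hKL : iwasawa_existsUnique_kubotaLeopoldtSeries`, the ONLY fact binder of this file);
* (A5) `exists_gaussSqrt` — for odd squarefree `m` an element `G ∈ rootField m = ℚ(μ_m)`, `G ≠ 0`, `G² = χ₄(m)·m`, on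
  which every `σ ∈ Aut(ℚ̄/ℚ)` with `σζ = ζ^a (ζ ∈ μ_m)` acts by the Jacobi symbol `(a | m)` (prime-by-prime: Mathlib
  `gaussSum_sq` on the FIELD `ZMod q`, `gaussSum_mulShift`, induction `Nat.recOnPosPrimePosCoprime`); hence
  `quadraticField_le_adjoin_rootsOfUnity` (`ℚ(√D) ⊆ ℚ(μ_{|D|})`, the letter of `F₀_le`).
§B THE FRAME INPUTS at `(p, level) = (7, |D|)` — field (FactorisationShape line) ↦ declaration here (hypotheses), each
conclusion in the EXACT letter of the field (`D`-hypotheses: `hD : D < 0`, `hD4 : D % 4 = 1`, `hsq : Squarefree D`,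
`h7 : ¬ 7 ∣ D`, instance `[NeZero D.natAbs]` (from `hD`); `hKL` the displayed named fact, for `g` only, as the row card says):
  `v`, `seven_mem_v` (l.113–114) ↦ `placeSeven`, `seven_mem_placeSeven` · `F₀`, `F₀_eq`, `F₀_le` (l.116–119) ↦ `F₀ D`,
  `F₀_eq` (rfl), `F₀_le (hD hD4 hsq)` · `ζsys`, `ζsys_compatible` (l.121–122) ↦ `ζsys D`, `ζsys_compatible (h7)` (ONE
  root system: `Kato2004.primitiveRootUnit ℚ 7 (n+1) · ζ_{|D|}^{(7⁻¹ mod |D|)^{n+1}}`; `ζsys_pow_natAbs` = the sharing with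
  `KummerFrame.ζ`) · `u`, `u_topGenerator` (l.124–125) ↦ `u` (`coe_u : u = 64`), `u_topGenerator` · `γ₀`,
  `cyclotomicCharacter_γ₀`, `γ₀_mem` (l.127–129) ↦ `γ₀ = σ₈²` (`cyclotomicCharacter_σ₈ : χ₇ σ₈ = 8`, `σ₈` trivial on
  prime-to-7 roots of unity), `cyclotomicCharacter_γ₀` (rfl), `γ₀_mem (hD hD4 hsq h7)` · `χD`, `χD_isPrimitive`, `χD_mul_self`,
  `χD_neg_one` (l.131–134) ↦ `χD D = jacobiCharInt |D| ∘ (ℤ → ℤ₇)`, `χD_isPrimitive (hD4 hsq)`, `χD_mul_self`, `χD_neg_one (hD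
  hD4)` · `ω`, `ω_teichmuller` (l.136–137) ↦ `ω = MulChar.ofUnitHom (Kato2004.teichmullerChar 7)`, `ω_teichmuller` ·
  `etaOne_isPrimitive` (l.141–142) ↦ `etaOne_isPrimitive (hD4 hsq h7)` (via `isPrimitive_mul_of_coprime_levels`) · `η₁`,
  `η₁_trivial`, `η₁_reading` (l.143–147) ↦ `η₁ D h7` (`= toUnitHom (χ_D ω⁵) ∘ galToPow`, `galToPow` = Mathlib
  `IsPrimitiveRoot.autToPow` of `ζsys D 0` along `absoluteGaloisGroup.toAlgEquiv`), `η₁_trivial (hD hD4 hsq h7)`, `η₁_reading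
  (h7)` · `g`, `g_spec` (l.148–150) ↦ `g D hKL hD4 hsq h7`, `g_spec` · `r`, `r_logTable` (l.153–154) ↦ `r`, `r_logTable`.
  NOT HERE: `D … normA_coprime` (road parameters l.102–111) and `U` (l.156–157, row K2C-13 ★).
  ASSEMBLY CHECK `mkGenusFrame D hD hD4 hsq h7 N hN hNc hKL U : GenusFrame` — the kernel's certificate that the §B
  declarations fill EVERY field l.113–154 in its exact letter (parameters and `U` as arguments); axioms of `mkGenusFrame`:
  `propext, Classical.choice, Quot.sound`.

FINDINGS (boxed for the pen; none is a letter deviation):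
  ┌ (F1) `hKL`.  `g`/`g_spec` are the only declarations under the named fact `iwasawa_existsUnique_kubotaLeopoldtSeries`
  │      (row card: «displayed hypothesis hKL»); `genusFrameOf … (hKL) …` must thread it.  Everything else is unconditional.
  │ (F2) `[NeZero D.natAbs]`.  `χD`, `zetaLevel/ζsys`, `etaOne/galToPow/η₁`, `g` carry the instance binder (Mathlib's
  │      `jacobiCharInt`/`DirichletCharacter` API wants it); at the frame constructor: `haveI := ⟨Int.natAbs_ne_zero.mpr hD.ne⟩`.
  │      The field `g_spec : ∀ [NeZero D.natAbs], …` is then `g_spec D hKL hD4 hsq h7` (instances of a `Prop`-class agree).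
  │ (F3) ℚ-ALGEBRA DIAMOND on `ℚ̄`.  A freshly elaborated `ℚ̄ ≃ₐ[ℚ] ℚ̄` / `IntermediateField ℚ ℚ̄` picks Mathlib's
  │      `DivisionRing.toRatAlgebra`, while `absoluteGaloisGroup.toAlgEquiv ℚ σ` lands at `AlgebraicClosure.instAlgebra ℚ`; the two
  │      are DEFINITIONALLY equal but not at `instances` transparency: pass between them with `exact`/`Eq.trans`, never `rw`
  │      (see `η₁_trivial`, χ_D-part).  No statement is affected.
  │ (F4) `MulChar.ofUnitHom (f ^ n) = MulChar.ofUnitHom f ^ n` (`ofUnitHom_pow`) is not in Mathlib; 3 lines here.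
  └ (F5) `u = 64`, `χ₇(σ₈) = 8`, `γ₀ = σ₈²` exactly as the row card; `σ₈` is CHOSEN (surjectivity of `χ₇` + prime-to-7
         splitting, `Classical.choose`), so `γ₀`, `u`, `r`, `g` are noncomputable but closed terms.

HONEST LABEL: infrastructure (definitions + kernel lemmas); it closes no item, registers no stub, proves no summit
statement; stmt-BirchSwinnertonDyer-19945 is OPEN; `X12.CMRamifiedSeven` is NOT proved; BSD is claimed for no curve.
No `sorry`, no `instance`, no `notation`/`macro`, no named fact introduced, no attribute removed.

References: [Lang1990] S. Lang, Cyclotomic Fields I and II, Ch. 10 §1 (PDF p. 167: `γ`, `⟨a⟩ = γ^{α(a)}`, `r(a)`);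
[Tsuji1999] T. Tsuji, Semi-local units modulo cyclotomic units, J. Number Theory 78 (1999), §3–§4; [Washington1997]
L. Washington, Introduction to Cyclotomic Fields, Ch. 3–4 (conductors; Gauss sums, Lemma 4.7–4.8), Ch. 14 (p. 321);
[IrelandRosen1990] K. Ireland, M. Rosen, A Classical Introduction to Modern Number Theory, Ch. 6 §3 (the sign of the
quadratic Gauss sum squared, `g² = (−1)^{(p−1)/2} p`) and Ch. 13 §3; [Kato2004Asterisque] K. Kato, Astérisque 295, §15.5.
-/

noncomputable section

set_option linter.dupNamespace false -- (the `Cruxes/` namespace repeats `BirchSwinnertonDyer`; drop on port)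

open scoped NumberField
open PowerSeries IsDedekindDomain
open Literature.NumberTheory.EllipticCurves
open Literature.NumberTheory.EllipticCurves.IwasawaAlgebra
open Literature.NumberTheory.IwasawaTheory
open Literature.NumberTheory.IwasawaTheory.StickelbergerSeries
open Literature.NumberTheory.ComplexMultiplication.EllipticUnits

namespace Summit.BirchSwinnertonDyer.BirchSwinnertonDyer.Cruxes.EllipticUnitValueSevenOfGZK.K2C14

/-! ## §A1 The powers of a topological generator exhaust `1 + pℤ_p` modulo `p^{n+1}` (Lang Ch. 10 §1) -/

section TopGenerator

variable {p : ℕ} [Fact p.Prime]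

/-- An element `t ≡ 1 (mod p)` of `ℤ_p` is a unit. [cite: Lang1990, Ch. 10 §1 (PDF p. 167, «1 + pℤ_p»)] -/
theorem isUnit_of_sub_one_mem_span {t : ℤ_[p]} (ht : t - 1 ∈ Ideal.span {(p : ℤ_[p])}) : IsUnit t := by
  rcases IsLocalRing.isUnit_or_isUnit_one_sub_self t with h | h
  · exact h
  · exfalso
    have hmem : 1 - t ∈ IsLocalRing.maximalIdeal ℤ_[p] := by
      rw [PadicInt.maximalIdeal_eq_span_p, ← Ideal.neg_mem_iff, neg_sub]; exact ht
    exact ((IsLocalRing.mem_maximalIdeal _).mp hmem) h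

/-- The image of a unit of `ℤ_p` in `(ℤ/p^{n+1})^×`. [cite: Lang1990, Ch. 10 §1 (PDF p. 167)] -/
def unitMod (n : ℕ) {x : ℤ_[p]} (hx : IsUnit x) : (ZMod (p ^ (n + 1)))ˣ :=
  Units.map (PadicInt.toZModPow (n + 1) : ℤ_[p] →+* ZMod (p ^ (n + 1))).toMonoidHom hx.unit

/-- The underlying residue of `unitMod`. [cite: Lang1990, Ch. 10 §1 (PDF p. 167)] -/
theorem coe_unitMod (n : ℕ) {x : ℤ_[p]} (hx : IsUnit x) :
    ((unitMod n hx : (ZMod (p ^ (n + 1)))ˣ) : ZMod (p ^ (n + 1))) = PadicInt.toZModPow (n + 1) x := by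
  simp [unitMod]

/-- `unitMod n hx` reduces to `1` modulo `p` iff `x ≡ 1 (mod p)`. [cite: Lang1990, Ch. 10 §1 (PDF p. 167)] -/
theorem unitsMap_unitMod_eq_one_iff (n : ℕ) {x : ℤ_[p]} (hx : IsUnit x) :
    ZMod.unitsMap (pow_dvd_pow p (Nat.le_add_left 1 n)) (unitMod n hx) = 1 ↔
      x - 1 ∈ Ideal.span {(p : ℤ_[p])} := by
  rw [← Units.val_eq_one, ZMod.unitsMap_val, coe_unitMod, PadicInt.cast_toZModPow 1 (n + 1) (Nat.le_add_left 1 n),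
    ← map_one (PadicInt.toZModPow 1), ← RingHom.sub_mem_ker_iff, PadicInt.ker_toZModPow, pow_one]

/-- **The powers of a topological generator `u` of `1 + pℤ_p` (`p` odd) exhaust `1 + pℤ_p` modulo `p^{n+1}`**: for every
`t ≡ 1 (mod p)` there is `k` with `u^k ≡ t (mod p^{n+1})` — the subgroup generated by `u` in the kernel of
`(ℤ/p^{n+1})^× → (ℤ/p)^×` (order `pⁿ`) has order `≥ pⁿ` by the tree's `IsTopGenerator.prime_pow_dvd_of_pow_sub_one_mem`
(`u^k ≡ 1 ⇒ pⁿ ∣ k`), hence is the whole kernel (Lang: «`⟨a⟩ = γ^{α(a)}`»). [cite: Lang1990, Ch. 10 §1 (PDF p. 167) and Thm. 1.2 (PDF p. 168)] -/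
theorem exists_pow_sub_mem_span_pow_of_isTopGenerator (hp : p ≠ 2) {u : ℤ_[p]} (hu : KubotaLeopoldt.IsTopGenerator p u)
    {t : ℤ_[p]} (ht : t - 1 ∈ Ideal.span {(p : ℤ_[p])}) (n : ℕ) :
    ∃ k : ℕ, u ^ k - t ∈ Ideal.span {(p : ℤ_[p]) ^ (n + 1)} := by
  classical
  have hpr : p.Prime := Fact.out
  haveI : NeZero (p ^ (n + 1)) := ⟨pow_ne_zero _ hpr.ne_zero⟩
  haveI : NeZero (p ^ 1) := ⟨pow_ne_zero _ hpr.ne_zero⟩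
  have huU : IsUnit u := hu.isUnit
  have htU : IsUnit t := isUnit_of_sub_one_mem_span ht
  have hu1 : u - 1 ∈ Ideal.span {(p : ℤ_[p])} := by
    rw [← pow_one (p : ℤ_[p]), ← PadicInt.norm_le_pow_iff_mem_span_pow, hu]; simp
  set ū : (ZMod (p ^ (n + 1)))ˣ := unitMod n huU with hūdef
  set tū : (ZMod (p ^ (n + 1)))ˣ := unitMod n htU with htūdef
  set φ : (ZMod (p ^ (n + 1)))ˣ →* (ZMod (p ^ 1))ˣ := ZMod.unitsMap (pow_dvd_pow p (Nat.le_add_left 1 n)) with hφ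
  have hūker : ū ∈ φ.ker := (MonoidHom.mem_ker).mpr ((unitsMap_unitMod_eq_one_iff n huU).mpr hu1)
  have htker : tū ∈ φ.ker := (MonoidHom.mem_ker).mpr ((unitsMap_unitMod_eq_one_iff n htU).mpr ht)
  -- `#ker φ = pⁿ`
  have hsurj : Function.Surjective φ := ZMod.unitsMap_surjective _
  have hindex : φ.ker.index = p - 1 := by
    rw [Subgroup.index_ker, MonoidHom.range_eq_top.mpr hsurj, Subgroup.card_top, Nat.card_eq_fintype_card,
      ZMod.card_units_eq_totient, Nat.totient_prime_pow_succ hpr, pow_zero, one_mul]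
  have hcardG : Nat.card (ZMod (p ^ (n + 1)))ˣ = p ^ n * (p - 1) := by
    rw [Nat.card_eq_fintype_card, ZMod.card_units_eq_totient, Nat.totient_prime_pow_succ hpr]
  have hcardK : Nat.card φ.ker = p ^ n := by
    have h := Subgroup.card_mul_index φ.ker
    rw [hindex, hcardG] at h
    exact Nat.eq_of_mul_eq_mul_right (by have := hpr.two_le; omega) h
  -- `pⁿ ≤ orderOf ū`
  have hord : p ^ n ≤ orderOf ū := by
    have h1 : ((ū ^ orderOf ū : (ZMod (p ^ (n + 1)))ˣ) : ZMod (p ^ (n + 1))) = 1 := by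
      rw [pow_orderOf_eq_one, Units.val_one]
    rw [Units.val_pow_eq_pow_val, hūdef, coe_unitMod, ← map_pow, ← map_one (PadicInt.toZModPow (n + 1)),
      ← RingHom.sub_mem_ker_iff, PadicInt.ker_toZModPow] at h1
    exact Nat.le_of_dvd (orderOf_pos ū) (KubotaLeopoldt.IsTopGenerator.prime_pow_dvd_of_pow_sub_one_mem p hp hu h1)
  -- hence `⟨ū⟩ = ker φ ∋ tū`
  have hle : Subgroup.zpowers ū ≤ φ.ker := (Subgroup.zpowers_le).mpr hūker
  have heq : Subgroup.zpowers ū = φ.ker :=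
    Subgroup.eq_of_le_of_card_ge hle (by rw [hcardK, Nat.card_zpowers]; exact hord)
  have htmem : tū ∈ Submonoid.powers ū :=
    ((isOfFinOrder_of_finite ū).mem_powers_iff_mem_zpowers).mpr (heq ▸ htker)
  obtain ⟨k, hk⟩ := (Submonoid.mem_powers_iff _ _).mp htmem
  refine ⟨k, ?_⟩
  have hk' := congrArg (fun z : (ZMod (p ^ (n + 1)))ˣ => (z : ZMod (p ^ (n + 1)))) hk
  simp only [Units.val_pow_eq_pow_val, hūdef, htūdef, coe_unitMod, ← map_pow] at hk'
  rw [← PadicInt.ker_toZModPow, RingHom.sub_mem_ker_iff]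
  exact hk'

/-! ## §A2 A `γ`-log table exists (`IsLogTable p u ω r`, any odd `p`, any top generator `u`, Teichmüller `ω`) -/

/-- **Existence of a `γ`-log table** (memo §1(b) row «`r` 153 / `r_logTable` 154»; Lang Ch. 10 §1 «`a = ω(a)⟨a⟩`,
`⟨a⟩ = γ^{α(a)}`, `r(a) ≡ α(a) mod pⁿ`»): for `p` odd, `u` a topological generator of `1 + pℤ_p` and `ω` the
(`ℤ_p`-valued) Teichmüller character there is `r : ℕ → ℕ → ℕ` with `u^{r n a}·ω(a) ≡ a (mod p^{n+1})` for all `a`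
prime to `p` — by (A1) at `t = a·ω(a)⁻¹ ≡ 1 (mod p)`.  Stated at the generality of `IsLogTable` (pen D1048 (ii)).
[cite: Lang1990, Ch. 10 §1 (PDF p. 167) and Thm. 1.2 (PDF p. 168)] -/
theorem exists_isLogTable (hp : p ≠ 2) {u : ℤ_[p]} (hu : KubotaLeopoldt.IsTopGenerator p u)
    {ω : DirichletCharacter ℤ_[p] p} (hω : IsTeichmullerCharacter p ω) :
    ∃ r : ℕ → ℕ → ℕ, IsLogTable p u ω r := by
  classical
  have key : ∀ n a : ℕ, a.Coprime p →
      ∃ k : ℕ, u ^ k * ω (a : ZMod p) - (a : ℤ_[p]) ∈ Ideal.span {(p : ℤ_[p]) ^ (n + 1)} := by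
    intro n a ha
    let aU : (ZMod p)ˣ := ZMod.unitOfCoprime a ha
    have haU : (aU : ZMod p) = a := ZMod.coe_unitOfCoprime a ha
    set w : ℤ_[p]ˣ := MulChar.toUnitHom ω aU with hw
    have hωa : ω (a : ZMod p) = (w : ℤ_[p]) := by rw [← haU, hw, MulChar.coe_toUnitHom]
    have hwmod : PadicInt.toZMod (w : ℤ_[p]) = (aU : ZMod p) := by rw [← hωa, ← haU]; exact hω aU
    -- `t = a·w⁻¹ ≡ 1 (mod p)`
    have ht : (a : ℤ_[p]) * ((w⁻¹ : ℤ_[p]ˣ) : ℤ_[p]) - 1 ∈ Ideal.span {(p : ℤ_[p])} := by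
      rw [← PadicInt.maximalIdeal_eq_span_p, ← PadicInt.ker_toZMod, RingHom.sub_mem_ker_iff, map_mul, map_one,
        map_natCast]
      have h2 : PadicInt.toZMod ((w⁻¹ : ℤ_[p]ˣ) : ℤ_[p]) * PadicInt.toZMod (w : ℤ_[p]) = 1 := by
        rw [← map_mul, Units.inv_mul, map_one]
      rw [← haU, ← hwmod, mul_comm]
      exact h2
    obtain ⟨k, hk⟩ := exists_pow_sub_mem_span_pow_of_isTopGenerator hp hu ht n
    refine ⟨k, ?_⟩
    have e : u ^ k * ω (a : ZMod p) - (a : ℤ_[p]) =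
        (w : ℤ_[p]) * (u ^ k - (a : ℤ_[p]) * ((w⁻¹ : ℤ_[p]ˣ) : ℤ_[p])) := by
      rw [hωa, mul_sub, ← mul_assoc, mul_comm (w : ℤ_[p]) (a : ℤ_[p]), mul_assoc, Units.mul_inv, mul_one, mul_comm]
    rw [e]
    exact Ideal.mul_mem_left _ _ hk
  choose! r hr using key
  exact ⟨r, fun n a ha => hr n a ha⟩

end TopGenerator

/-! ## §A3 `ℤ_p`-descent of integral series of a `ℤ_p`-valued character (memo §1(c)) -/

section Descent

variable {p : ℕ} [Fact p.Prime] {f : ℕ}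

/-- `intAlgebraMap p : ℤ_p → ℂ_p` is injective (it is isometric, `KubotaLeopoldt.norm_intAlgebraMap`); the `p = 7`
instance is `GenusSeven.intAlgebraMap_injective` (GenusResidue). [cite: Lang1990, Ch. 10 §1 (PDF p. 167, `𝔬 ⊂ ℂ_p`)] -/
theorem intAlgebraMap_injective (p : ℕ) [Fact p.Prime] : Function.Injective (KubotaLeopoldt.intAlgebraMap p) := by
  refine (injective_iff_map_eq_zero _).mpr fun x hx => ?_
  have h := KubotaLeopoldt.norm_intAlgebraMap p x
  rw [hx, norm_zero] at h
  exact norm_eq_zero.mp h.symm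

/-- **For a `ℤ_p`-VALUED character the coefficient ring `ℤ_p[ψ] ⊆ ℂ_p` is (the image of) `ℤ_p`** (Tsuji p. 1
«the ring generated by the values of `χ` over `ℤ_p`» — here the values already lie in `ℤ_p`). [cite: Tsuji1999, §1 p. 1 and §4 Definition p. 12] -/
theorem coeffSubring_ringHomComp_intAlgebraMap (ψ : DirichletCharacter ℤ_[p] f) :
    KubotaLeopoldt.coeffSubring p (ψ.ringHomComp (KubotaLeopoldt.intAlgebraMap p)) =
      (KubotaLeopoldt.intAlgebraMap p).range := by
  apply le_antisymm
  · refine Subring.closure_le.mpr ?_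
    rintro x (⟨z, rfl⟩ | ⟨a, rfl⟩)
    · exact ⟨z, rfl⟩
    · exact ⟨ψ a, rfl⟩
  · rintro x ⟨z, rfl⟩
    exact KubotaLeopoldt.intAlgebraMap_mem_coeffSubring p _ z

/-- **`ℤ_p`-descent**: a series integral for a `ℤ_p`-valued character is the image of a series over `ℤ_p`
(coefficientwise). [cite: Tsuji1999, §4 Definition p. 12 («`g_χ(T) ∈ ℤ_p[χ][[T]]`»)] -/
theorem exists_map_intAlgebraMap_eq (ψ : DirichletCharacter ℤ_[p] f) {g : PowerSeries ℂ_[p]}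
    (hg : KubotaLeopoldt.IsIntegral p (ψ.ringHomComp (KubotaLeopoldt.intAlgebraMap p)) g) :
    ∃ g₀ : PowerSeries ℤ_[p], PowerSeries.map (KubotaLeopoldt.intAlgebraMap p) g₀ = g := by
  classical
  have h : ∀ n : ℕ, ∃ c : ℤ_[p], KubotaLeopoldt.intAlgebraMap p c = PowerSeries.coeff n g := fun n => by
    have hn := hg n
    rw [coeffSubring_ringHomComp_intAlgebraMap] at hn
    exact hn
  choose c hc using h
  refine ⟨PowerSeries.mk c, ?_⟩
  ext n
  rw [PowerSeries.coeff_map, PowerSeries.coeff_mk, hc]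

/-! ## §A4 The `ℤ_p`-coefficient Kubota–Leopoldt series of a `ℤ_p`-valued primitive character (memo §1(c) rows «g», «g_spec») -/

/-- **Under Iwasawa's existence fact** (`hKL`, displayed; Tsuji p. 6, Thm. 4.3) a primitive `ℤ_p`-VALUED `ψ` mod `f`
(`p ∤ f`, `(f, i) ≠ (1, 0)`, `i ≤ p − 2`) has a Kubota–Leopoldt series WITH COEFFICIENTS IN `ℤ_p`:
existence in `ℂ_p⟦T⟧` with coefficients in `ℤ_p[ψ] = ℤ_p` (A3), then descent. [cite: Tsuji1999, p. 6 L17–21 and §4 Thm. 4.3 (pp. 12–13)] [cite: Lang1990, Ch. 10 §2 (PDF p. 171)] -/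
theorem exists_int_kubotaLeopoldtSeries (hKL : iwasawa_existsUnique_kubotaLeopoldtSeries) (hp : p ≠ 2)
    [NeZero f] (hf : f.Coprime p) {ψ : DirichletCharacter ℤ_[p] f} (hψ : ψ.IsPrimitive) {i : ℕ} (hi : i ≤ p - 2)
    (hχ : ¬ (f = 1 ∧ i = 0)) {u : ℤ_[p]} (hu : KubotaLeopoldt.IsTopGenerator p u) :
    ∃ g₀ : PowerSeries ℤ_[p],
      IsKubotaLeopoldtSeries p (ψ.ringHomComp (KubotaLeopoldt.intAlgebraMap p)) i u
        (PowerSeries.map (KubotaLeopoldt.intAlgebraMap p) g₀) := by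
  have hψ' : DirichletCharacter.IsPrimitive (ψ.ringHomComp (KubotaLeopoldt.intAlgebraMap p)) :=
    (Kato2004.LayerCharacterTwo.isPrimitive_ringHomComp_iff ψ (intAlgebraMap_injective p)).mpr hψ
  obtain ⟨g, hgint, hg⟩ := exists_kubotaLeopoldtSeries hKL hp hf hψ' hi hχ hu
  obtain ⟨g₀, rfl⟩ := exists_map_intAlgebraMap_eq ψ hgint
  exact ⟨g₀, hg⟩

end Descent

/-! ## §A5 Gauss sums: `√(χ₄(m)·m) ∈ ℚ(μ_m)` with its Galois action by the Jacobi symbol (memo §1(b) row «F₀_le», M, template-less) -/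

section Gauss

/-- `ℚ(μ_N) ⊆ ℚ̄` as an intermediate field: `ℚ` adjoined the `N`-th roots of unity (the letter of `GenusFrame.F₀_le`,
l.119, and of `cyclotomicLayer`). [cite: Washington1997, Ch. 2 (cyclotomic fields `ℚ(ζ_N)`)] -/
def rootField (N : ℕ) : IntermediateField ℚ (AlgebraicClosure ℚ) :=
  IntermediateField.adjoin ℚ {x : AlgebraicClosure ℚ | x ^ N = 1}

/-- Unfolding `rootField`. [cite: Washington1997, Ch. 2] -/
theorem rootField_def (N : ℕ) :
    rootField N = IntermediateField.adjoin ℚ {x : AlgebraicClosure ℚ | x ^ N = 1} := rfl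

/-- A root of unity of order dividing `N` lies in `ℚ(μ_N)`. [cite: Washington1997, Ch. 2] -/
theorem mem_rootField_of_pow_eq_one {N : ℕ} {ζ : AlgebraicClosure ℚ} (h : ζ ^ N = 1) : ζ ∈ rootField N :=
  IntermediateField.subset_adjoin ℚ _ h

/-- `ℚ(μ_N) ⊆ ℚ(μ_M)` for `N ∣ M`. [cite: Washington1997, Ch. 2] -/
theorem rootField_mono {N M : ℕ} (h : N ∣ M) : rootField N ≤ rootField M := by
  apply IntermediateField.adjoin.mono
  intro x hx
  obtain ⟨k, rfl⟩ := h
  simp only [Set.mem_setOf_eq] at hx ⊢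
  rw [pow_mul, hx, one_pow]

/-- **Quadratic Gauss sum at an odd prime `q`, in `ℚ̄`**: there is `G ∈ ℚ(μ_q)`, `G ≠ 0`, with `G² = χ₄(q)·q`
(`= (−1)^{(q−1)/2} q`, Ireland–Rosen Ch. 6 §3; Mathlib `gaussSum_sq` for the quadratic character of the FIELD
`ZMod q` and a primitive additive character) on which every `σ ∈ Aut(ℚ̄/ℚ)` with `σζ = ζ^a` (`ζ ∈ μ_q`) acts by the
Legendre symbol: `σG = (a | q)·G` (`gaussSum_mulShift`: `g(χ, ψ^a) = χ(a)⁻¹ g(χ, ψ)`). [cite: IrelandRosen1990, Ch. 6 §3 (Prop. 6.3.2, `g² = (−1)^{(p−1)/2} p`) and Ch. 13 §3] [cite: Washington1997, Ch. 4 Lemma 4.7–4.8] -/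
theorem exists_gaussSqrt_prime (q : ℕ) [hq : Fact q.Prime] (hq2 : q ≠ 2) :
    ∃ G ∈ rootField q, G ^ 2 = ((ZMod.χ₄ q : ℤ) : AlgebraicClosure ℚ) * q ∧ G ≠ 0 ∧
      ∀ (σ : AlgebraicClosure ℚ ≃ₐ[ℚ] AlgebraicClosure ℚ) (a : ℕ),
        (∀ ζ : AlgebraicClosure ℚ, ζ ^ q = 1 → σ ζ = ζ ^ a) →
          σ G = (jacobiSym a q : AlgebraicClosure ℚ) * G := by
  classical
  obtain ⟨ζ, hζ⟩ := HasEnoughRootsOfUnity.exists_primitiveRoot (AlgebraicClosure ℚ) q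
  have hζ1 : ζ ^ q = 1 := hζ.pow_eq_one
  set ψ : AddChar (ZMod q) (AlgebraicClosure ℚ) := AddChar.zmodChar q hζ1 with hψdef
  have hψ : ψ.IsPrimitive := AddChar.zmodChar_primitive_of_primitive_root q hζ
  set χ : MulChar (ZMod q) (AlgebraicClosure ℚ) :=
    (quadraticChar (ZMod q)).ringHomComp (Int.castRingHom (AlgebraicClosure ℚ)) with hχdef
  have hχapp : ∀ x, χ x = ((quadraticChar (ZMod q) x : ℤ) : AlgebraicClosure ℚ) := fun x => rfl
  have hring : ringChar (ZMod q) ≠ 2 := by rw [ZMod.ringChar_zmod_n]; exact hq2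
  have hχ2 : χ.IsQuadratic := (quadraticChar_isQuadratic (ZMod q)).comp _
  have hχ1 : χ ≠ 1 := by
    obtain ⟨a, ha⟩ := quadraticChar_exists_neg_one hring
    have ha0 : a ≠ 0 := by
      rintro rfl
      rw [quadraticChar_zero] at ha
      exact absurd ha (by decide)
    intro h
    have h1 : χ a = 1 := by rw [h, MulChar.one_apply (isUnit_iff_ne_zero.mpr ha0)]
    rw [hχapp, ha] at h1
    norm_num at h1
  have hGsq : gaussSum χ ψ ^ 2 = ((ZMod.χ₄ q : ℤ) : AlgebraicClosure ℚ) * q := by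
    rw [gaussSum_sq hχ1 hχ2 hψ, ZMod.card, hχapp, quadraticChar_neg_one hring, ZMod.card]
  refine ⟨gaussSum χ ψ, ?_, hGsq, ?_, ?_⟩
  · -- membership in `ℚ(μ_q)`
    unfold gaussSum
    refine sum_mem fun x _ => mul_mem ?_ ?_
    · rw [hχapp]; exact intCast_mem _ _
    · rw [hψdef, AddChar.zmodChar_apply]; exact pow_mem (mem_rootField_of_pow_eq_one hζ1) _
  · -- `G ≠ 0`
    intro h0
    rw [h0, zero_pow two_ne_zero, eq_comm, mul_eq_zero] at hGsq
    rcases hGsq with h | h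
    · rw [Int.cast_eq_zero, ZMod.χ₄_eq_neg_one_pow (Nat.odd_iff.mp (hq.1.odd_of_ne_two hq2))] at h
      exact pow_ne_zero _ (by norm_num) h
    · exact (Nat.cast_ne_zero.mpr hq.1.ne_zero) h
  · intro σ a hσ
    by_cases hqa : (a : ZMod q) = 0
    · exfalso
      obtain ⟨c, hc⟩ := (ZMod.natCast_eq_zero_iff a q).mp hqa
      have h1 : σ ζ = 1 := by rw [hσ ζ hζ1, hc, pow_mul, hζ1, one_pow]
      have h2 : ζ = 1 := by
        have := congrArg σ.symm h1
        rwa [AlgEquiv.symm_apply_apply, map_one] at this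
      exact hζ.ne_one hq.1.one_lt h2
    · have haU : IsUnit (a : ZMod q) := isUnit_iff_ne_zero.mpr hqa
      have hσG : σ (gaussSum χ ψ) = gaussSum χ (ψ.mulShift (a : ZMod q)) := by
        unfold gaussSum
        rw [map_sum]
        refine Finset.sum_congr rfl fun x _ => ?_
        rw [map_mul, AddChar.mulShift_apply, hχapp, map_intCast, hψdef, AddChar.zmodChar_apply,
          AddChar.zmodChar_apply, map_pow, hσ ζ hζ1, ← pow_mul, ZMod.val_mul, ZMod.val_natCast,
          pow_eq_pow_mod (a * x.val) hζ1, ← pow_eq_pow_mod _ hζ1, Nat.mul_mod, Nat.mod_mod, ← Nat.mul_mod,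
          ← pow_eq_pow_mod _ hζ1]
      have hmul := gaussSum_mulShift χ ψ haU.unit
      rw [haU.unit_spec] at hmul
      have hχa : χ (a : ZMod q) = (jacobiSym a q : AlgebraicClosure ℚ) := by
        rw [hχapp, ← jacobiSym.legendreSym.to_jacobiSym, legendreSym, Int.cast_natCast]
      have hsq : χ (a : ZMod q) * χ (a : ZMod q) = 1 := by
        rcases hχ2 (a : ZMod q) with h | h | h
        · exfalso
          rw [hχapp, Int.cast_eq_zero, quadraticChar_eq_zero_iff] at h
          exact hqa h
        · rw [h, one_mul]
        · rw [h]; norm_num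
      calc σ (gaussSum χ ψ) = gaussSum χ (ψ.mulShift (a : ZMod q)) := hσG
        _ = χ (a : ZMod q) * (χ (a : ZMod q) * gaussSum χ (ψ.mulShift (a : ZMod q))) := by
          rw [← mul_assoc, hsq, one_mul]
        _ = (jacobiSym a q : AlgebraicClosure ℚ) * gaussSum χ ψ := by rw [hmul, hχa]

/-- **`√(χ₄(m)·m) ∈ ℚ(μ_m)` for odd squarefree `m`, with Galois action by the Jacobi symbol** (product of the prime
Gauss sums over `q ∣ m`: `G = ∏ g_q`, `G² = ∏ χ₄(q) q = χ₄(m) m`, `σG = ∏ (a|q)·G = (a|m)·G`; induction over the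
coprime factorisation `Nat.recOnPosPrimePosCoprime`). [cite: IrelandRosen1990, Ch. 6 §3 and Ch. 13 §3] [cite: Washington1997, Ch. 4 Lemma 4.8] -/
theorem exists_gaussSqrt {m : ℕ} (hm : Odd m) (hsq : Squarefree m) :
    ∃ G ∈ rootField m, G ^ 2 = ((ZMod.χ₄ m : ℤ) : AlgebraicClosure ℚ) * m ∧ G ≠ 0 ∧
      ∀ (σ : AlgebraicClosure ℚ ≃ₐ[ℚ] AlgebraicClosure ℚ) (a : ℕ),
        (∀ ζ : AlgebraicClosure ℚ, ζ ^ m = 1 → σ ζ = ζ ^ a) →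
          σ G = (jacobiSym a m : AlgebraicClosure ℚ) * G := by
  induction m using Nat.recOnPosPrimePosCoprime with
  | zero => exact (not_squarefree_zero hsq).elim
  | one =>
    refine ⟨1, one_mem _, by simp, one_ne_zero, fun σ a _ => ?_⟩
    rw [map_one, jacobiSym.one_right, Int.cast_one, one_mul]
  | prime_pow q n hq hn =>
    rcases Squarefree.eq_zero_or_one_of_pow_of_not_isUnit hsq hq.not_isUnit with h | h
    · omega
    · subst h
      haveI : Fact q.Prime := ⟨hq⟩
      have hq2 : q ≠ 2 := by rintro rfl; exact absurd hm (by decide)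
      simpa only [pow_one] using exists_gaussSqrt_prime q hq2
  | coprime a b ha hb hab iha ihb =>
    have hma : Odd a := (Nat.odd_mul.mp hm).1
    have hmb : Odd b := (Nat.odd_mul.mp hm).2
    have hsa : Squarefree a := ((Nat.squarefree_mul hab).mp hsq).1
    have hsb : Squarefree b := ((Nat.squarefree_mul hab).mp hsq).2
    obtain ⟨G₁, hG₁mem, hG₁sq, hG₁ne, hG₁gal⟩ := iha hma hsa
    obtain ⟨G₂, hG₂mem, hG₂sq, hG₂ne, hG₂gal⟩ := ihb hmb hsb
    refine ⟨G₁ * G₂, mul_mem (rootField_mono (dvd_mul_right a b) hG₁mem) (rootField_mono (dvd_mul_left b a) hG₂mem),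
      ?_, mul_ne_zero hG₁ne hG₂ne, fun σ c hσ => ?_⟩
    · rw [mul_pow, hG₁sq, hG₂sq, Nat.cast_mul, Nat.cast_mul, map_mul, Int.cast_mul]; ring
    · have hσa : ∀ ζ : AlgebraicClosure ℚ, ζ ^ a = 1 → σ ζ = ζ ^ c := fun ζ hζ =>
        hσ ζ (by rw [pow_mul, hζ, one_pow])
      have hσb : ∀ ζ : AlgebraicClosure ℚ, ζ ^ b = 1 → σ ζ = ζ ^ c := fun ζ hζ =>
        hσ ζ (by rw [mul_comm, pow_mul, hζ, one_pow])
      rw [map_mul, hG₁gal σ c hσa, hG₂gal σ c hσb, jacobiSym.mul_right' (c : ℤ) (by omega : a ≠ 0) (by omega : b ≠ 0),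
        Int.cast_mul]
      ring

/-- **`ℚ(√D) ⊆ ℚ(μ_{|D|})`** for a negative squarefree `D ≡ 1 (mod 4)` — the letter of `GenusFrame.F₀_le` (l.119):
`|D| ≡ 3 (mod 4)` so `χ₄(|D|)·|D| = −|D| = D` and the Gauss product `G` of `exists_gaussSqrt` is a square root of `D`
in `ℚ(μ_{|D|})`; `x² = D ⇒ x = ±G`. [cite: Washington1997, Ch. 4 Lemma 4.8 and Ch. 2 (quadratic subfields of cyclotomic fields)] [cite: IrelandRosen1990, Ch. 6 §3] -/
theorem quadraticField_le_adjoin_rootsOfUnity {D : ℤ} (hD : D < 0) (hD4 : D % 4 = 1) (hsq : Squarefree D) :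
    IntermediateField.adjoin ℚ {x : AlgebraicClosure ℚ | x ^ 2 = (D : AlgebraicClosure ℚ)} ≤
      IntermediateField.adjoin ℚ {x : AlgebraicClosure ℚ | x ^ D.natAbs = 1} := by
  have hodd : Odd D.natAbs := by rw [Int.natAbs_odd]; exact Int.odd_iff.mpr (by omega)
  have hsq' : Squarefree D.natAbs := Int.squarefree_natAbs.mpr hsq
  have h3 : D.natAbs % 4 = 3 := by omega
  obtain ⟨G, hGmem, hGsq, -, -⟩ := exists_gaussSqrt hodd hsq'
  have hcast : ((D.natAbs : ℕ) : AlgebraicClosure ℚ) = -(D : AlgebraicClosure ℚ) := by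
    have : ((D.natAbs : ℕ) : ℤ) = -D := by omega
    rw [← Int.cast_natCast, this, Int.cast_neg]
  have hG2 : G ^ 2 = (D : AlgebraicClosure ℚ) := by
    rw [hGsq, ZMod.χ₄_nat_three_mod_four h3, hcast]; push_cast; ring
  rw [IntermediateField.adjoin_le_iff]
  intro x hx
  simp only [Set.mem_setOf_eq] at hx
  rw [← hG2, sq_eq_sq_iff_eq_or_eq_neg] at hx
  rcases hx with rfl | rfl
  · exact hGmem
  · exact neg_mem hGmem

end Gauss

/-! ## §B The frame inputs at `(p, level) = (7, |D|)` — one declaration per `GenusFrame` field (l.113–154), same names -/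

section Frame

open Field Literature.NumberTheory.GaloisRepresentations Literature.NumberTheory.QuadraticFields
open Summit.BirchSwinnertonDyer.Rank1Residual.Additive.GenusSeven

variable (D : ℤ)

/-! ### `v`, `seven_mem_v` (l.113–114) -/

/-- The place `7` of `ℚ` (Mathlib `Rat.HeightOneSpectrum.primesEquiv`). Field `v` (l.113). [cite: Tsuji1999, §3 (p. 5, «p an odd prime»)] -/
def placeSeven : HeightOneSpectrum (𝓞 ℚ) :=
  (Rat.HeightOneSpectrum.primesEquiv (R := 𝓞 ℚ)).symm ⟨7, Nat.prime_seven⟩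

/-- `7 ∈ v` — the letter of field `seven_mem_v` (l.114). [cite: Tsuji1999, §3 (p. 5)] -/
theorem seven_mem_placeSeven : ((7 : ℕ) : 𝓞 ℚ) ∈ placeSeven.asIdeal :=
  (natCast_mem_asIdeal_iff_eq_primesEquiv_symm placeSeven Nat.prime_seven).mpr rfl

/-! ### `F₀`, `F₀_eq`, `F₀_le` (l.116–119) -/

/-- `F₀ = ℚ(√D) ⊆ ℚ̄`. Field `F₀` (l.116). [cite: Tsuji1999, §3 (p. 5, «F»)] -/
def F₀ : IntermediateField ℚ (AlgebraicClosure ℚ) :=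
  IntermediateField.adjoin ℚ {x : AlgebraicClosure ℚ | x ^ 2 = (D : AlgebraicClosure ℚ)}

/-- The letter of field `F₀_eq` (l.117). [cite: Tsuji1999, §3 (p. 5)] -/
theorem F₀_eq : F₀ D = IntermediateField.adjoin ℚ {x : AlgebraicClosure ℚ | x ^ 2 = (D : AlgebraicClosure ℚ)} := rfl

/-- **`ℚ(√D) ⊆ ℚ(μ_{|D|})`** — the letter of field `F₀_le` (l.119), by §A5. [cite: Washington1997, Ch. 4 Lemma 4.8] -/
theorem F₀_le (hD : D < 0) (hD4 : D % 4 = 1) (hsq : Squarefree D) :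
    F₀ D ≤ IntermediateField.adjoin ℚ {x : AlgebraicClosure ℚ | x ^ D.natAbs = 1} :=
  quadraticField_le_adjoin_rootsOfUnity hD hD4 hsq

/-! ### `ζsys`, `ζsys_compatible` (l.121–122): ONE root system (`Kato2004.primitiveRootUnit ℚ 7` times a fixed `ζ_{|D|}`) -/

/-- A primitive `|D|`-th root of unity in `ℚ̄`. [cite: Washington1997, Ch. 2] -/
def zetaLevel [NeZero D.natAbs] : AlgebraicClosure ℚ :=
  (HasEnoughRootsOfUnity.exists_primitiveRoot (AlgebraicClosure ℚ) D.natAbs).choose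

/-- `zetaLevel D` is a primitive `|D|`-th root of unity. [cite: Washington1997, Ch. 2] -/
theorem isPrimitiveRoot_zetaLevel [NeZero D.natAbs] : IsPrimitiveRoot (zetaLevel D) D.natAbs :=
  (HasEnoughRootsOfUnity.exists_primitiveRoot (AlgebraicClosure ℚ) D.natAbs).choose_spec

/-- An inverse of `7` modulo `|D|`, as a natural number. [cite: Washington1997, Thm. 2.5 (CRT exponents)] -/
def invSeven : ℕ := ((7 : ZMod D.natAbs)⁻¹).val

/-- `invSeven D · 7 ≡ 1 (mod |D|)` for `7 ∤ D`. [cite: Washington1997, Thm. 2.5] -/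
theorem invSeven_mul_seven_mod [NeZero D.natAbs] (h7 : ¬ (7 : ℤ) ∣ D) :
    (invSeven D * 7) % D.natAbs = 1 % D.natAbs := by
  have hcop : (7 : ℕ).Coprime D.natAbs :=
    (Nat.Prime.coprime_iff_not_dvd Nat.prime_seven).mpr fun h => h7 (Int.ofNat_dvd_left.mpr h)
  have h1 : ((invSeven D * 7 : ℕ) : ZMod D.natAbs) = 1 := by
    rw [Nat.cast_mul, invSeven, ZMod.natCast_zmod_val, mul_comm]
    exact_mod_cast ZMod.coe_mul_inv_eq_one 7 hcop
  have h2 := congrArg ZMod.val h1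
  rwa [ZMod.val_natCast, ZMod.val_one_eq_one_mod] at h2

/-- `invSeven D` is prime to `|D|` (for `7 ∤ D`). [cite: Washington1997, Thm. 2.5] -/
theorem invSeven_coprime [NeZero D.natAbs] (h7 : ¬ (7 : ℤ) ∣ D) : (invSeven D).Coprime D.natAbs :=
  Nat.coprime_of_mul_modEq_one 7 (invSeven_mul_seven_mod D h7)

/-- **The compatible root system** `ζsys n = ζ_{7^{n+1}} · ζ_{|D|}^{(7⁻¹ mod |D|)^{n+1}}` (one `7`-power system —
`Kato2004.primitiveRootUnit ℚ 7` — for the whole file; no second root system). Field `ζsys` (l.121). [cite: Tsuji1999, §3 (p. 5, «ζ_{p^{n+1}}») and §5] -/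
def ζsys [NeZero D.natAbs] (n : ℕ) : AlgebraicClosure ℚ :=
  ((Kato2004.primitiveRootUnit ℚ 7 (n + 1) : (AlgebraicClosure ℚ)ˣ) : AlgebraicClosure ℚ) *
    zetaLevel D ^ (invSeven D ^ (n + 1))

/-- **`ζsys` is a compatible system of primitive `7^{n+1}|D|`-th roots of unity** — the letter of field
`ζsys_compatible` (l.122): primitivity = coprime orders `7^{n+1}` and `|D|` multiply; compatibility =
`ζ_{7^{n+2}}^7 = ζ_{7^{n+1}}` and `7·7⁻¹ ≡ 1 (mod |D|)`. [cite: Tsuji1999, §3 (p. 5) and §5 (p. 14)] [cite: Washington1997, Thm. 2.5] -/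
theorem ζsys_compatible [NeZero D.natAbs] (h7 : ¬ (7 : ℤ) ∣ D) :
    CyclotomicUnits.IsCompatibleRootSystem D.natAbs 7 (ζsys D) := by
  have hcop : (7 : ℕ).Coprime D.natAbs :=
    (Nat.Prime.coprime_iff_not_dvd Nat.prime_seven).mpr fun h => h7 (Int.ofNat_dvd_left.mpr h)
  have hζD : ∀ n : ℕ, IsPrimitiveRoot (zetaLevel D ^ (invSeven D ^ (n + 1))) D.natAbs := fun n =>
    (isPrimitiveRoot_zetaLevel D).pow_of_coprime _ ((invSeven_coprime D h7).pow_left _)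
  refine ⟨fun n => ?_, fun n => ?_⟩
  · have hx : IsPrimitiveRoot ((Kato2004.primitiveRootUnit ℚ 7 (n + 1) : (AlgebraicClosure ℚ)ˣ) : AlgebraicClosure ℚ)
        (7 ^ (n + 1)) := IsPrimitiveRoot.coe_units_iff.mpr (Kato2004.isPrimitiveRoot_primitiveRootUnit ℚ 7 (n + 1))
    have hy := hζD n
    have hco : (orderOf ((Kato2004.primitiveRootUnit ℚ 7 (n + 1) : (AlgebraicClosure ℚ)ˣ) : AlgebraicClosure ℚ)).Coprime
        (orderOf (zetaLevel D ^ (invSeven D ^ (n + 1)))) := by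
      rw [← hx.eq_orderOf, ← hy.eq_orderOf]; exact hcop.pow_left _
    have hord := Commute.orderOf_mul_eq_mul_orderOf_of_coprime (Commute.all _ _) hco
    rw [← hx.eq_orderOf, ← hy.eq_orderOf] at hord
    show IsPrimitiveRoot (((Kato2004.primitiveRootUnit ℚ 7 (n + 1) : (AlgebraicClosure ℚ)ˣ) : AlgebraicClosure ℚ) *
      zetaLevel D ^ (invSeven D ^ (n + 1))) (7 ^ (n + 1) * D.natAbs)
    rw [← hord]
    exact IsPrimitiveRoot.orderOf _
  · have hz : zetaLevel D ^ D.natAbs = 1 := (isPrimitiveRoot_zetaLevel D).pow_eq_one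
    show (((Kato2004.primitiveRootUnit ℚ 7 (n + 1 + 1) : (AlgebraicClosure ℚ)ˣ) : AlgebraicClosure ℚ) *
        zetaLevel D ^ (invSeven D ^ (n + 1 + 1))) ^ 7 =
      ((Kato2004.primitiveRootUnit ℚ 7 (n + 1) : (AlgebraicClosure ℚ)ˣ) : AlgebraicClosure ℚ) *
        zetaLevel D ^ (invSeven D ^ (n + 1))
    rw [mul_pow, ← Units.val_pow_eq_pow_val, Kato2004.primitiveRootUnit_succ_pow, ← pow_mul]
    congr 1
    rw [pow_eq_pow_mod _ hz, pow_eq_pow_mod (invSeven D ^ (n + 1)) hz, pow_succ (invSeven D) (n + 1), mul_assoc,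
      Nat.mul_mod, invSeven_mul_seven_mod D h7, ← Nat.mul_mod, mul_one]

/-- **Sharing with `KummerFrame.ζ`**: `(ζsys n)^{|D|} = ζ_{7^{n+1}}^{|D|}` with `ζ_{7^{n+1}} = Kato2004.primitiveRootUnit ℚ 7 (n+1)`
(the `7`-power part of `ζsys` IS the Kummer-frame root system). [cite: Kato2004Asterisque, §15.5 (p. 253)] [cite: Tsuji1999, p. 3 (Notation)] -/
theorem ζsys_pow_natAbs [NeZero D.natAbs] (n : ℕ) :
    ζsys D n ^ D.natAbs =
      ((Kato2004.primitiveRootUnit ℚ 7 (n + 1) : (AlgebraicClosure ℚ)ˣ) : AlgebraicClosure ℚ) ^ D.natAbs := by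
  show (((Kato2004.primitiveRootUnit ℚ 7 (n + 1) : (AlgebraicClosure ℚ)ˣ) : AlgebraicClosure ℚ) *
      zetaLevel D ^ (invSeven D ^ (n + 1))) ^ D.natAbs = _
  rw [mul_pow, ← pow_mul, mul_comm (invSeven D ^ (n + 1)) D.natAbs, pow_mul, (isPrimitiveRoot_zetaLevel D).pow_eq_one,
    one_pow, mul_one]

/-- `ζsys D 0` is a primitive `|D|·7`-th root of unity (the level of `η₁`). [cite: Tsuji1999, §4 (p. 12, «χ a character of Gal(ℚ(μ_{fp})/ℚ)»)] -/
theorem isPrimitiveRoot_ζsys_zero [NeZero D.natAbs] (h7 : ¬ (7 : ℤ) ∣ D) :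
    IsPrimitiveRoot (ζsys D 0) (D.natAbs * 7) := by
  have := (ζsys_compatible D h7).1 0
  rwa [zero_add, pow_one, mul_comm] at this

/-! ### `u`, `u_topGenerator`, `γ₀`, `cyclotomicCharacter_γ₀`, `γ₀_mem` (l.124–129): `γ₀ = σ₈²`, `u = χ₇(γ₀) = 64` -/

/-- `8 ∈ ℤ₇^×`. [cite: Lang1990, Ch. 10 §1 (PDF p. 167)] -/
theorem isUnit_eight : IsUnit (8 : ℤ_[7]) := by
  rw [PadicInt.isUnit_iff]
  refine le_antisymm (PadicInt.norm_le_one _) (not_lt.mp fun h => ?_)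
  have h' := (PadicInt.norm_int_lt_one_iff_dvd (p := 7) 8).mp (by exact_mod_cast h)
  revert h'; norm_num

/-- The unit `8` of `ℤ₇`. [cite: Lang1990, Ch. 10 §1 (PDF p. 167)] -/
def unitEight : ℤ_[7]ˣ := isUnit_eight.unit

/-- `(unitEight : ℤ₇) = 8`. [cite: Lang1990, Ch. 10 §1] -/
theorem coe_unitEight : (unitEight : ℤ_[7]) = 8 := isUnit_eight.unit_spec

/-- Every cyclotomic polynomial is irreducible over `ℚ` (Mathlib), in the toolkit's shape. [cite: Washington1997, Thm. 2.5] -/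
theorem cyclotomic_irreducible : ∀ n : ℕ, 0 < n → Irreducible (Polynomial.cyclotomic n ℚ) :=
  fun _ hn => Polynomial.cyclotomic.irreducible_rat hn

/-- **`σ₈ ∈ Γ_ℚ`**: an automorphism with `χ₇(σ₈) = 8` acting TRIVIALLY on every root of unity of order prime to `7`
(surjectivity of `χ₇`, `GaloisRep.cyclotomicCharacter_surjective`, then splitting off the prime-to-`7` part,
`RootOfUnityAction.exists_smul_eq_smul_and_smul_eq_self`). [cite: Washington1997, Ch. 14 (p. 321, `Gal(ℚ(μ_∞)/ℚ) ≅ ∏ ℤ_p^×`)] -/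
def σ₈ : absoluteGaloisGroup ℚ :=
  (RootOfUnityAction.exists_smul_eq_smul_and_smul_eq_self (K := ℚ) cyclotomic_irreducible Nat.prime_seven
    (GaloisRep.cyclotomicCharacter_surjective ℚ 7 cyclotomic_irreducible unitEight).choose).choose

/-- `χ₇(σ₈) = 8`. [cite: Washington1997, Ch. 14 (p. 321)] -/
theorem cyclotomicCharacter_σ₈ : GaloisRep.cyclotomicCharacter ℚ 7 σ₈ = unitEight := by
  rw [← (GaloisRep.cyclotomicCharacter_surjective ℚ 7 cyclotomic_irreducible unitEight).choose_spec]
  exact cyclotomicCharacter_eq_of_forall_smul_eq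
    (RootOfUnityAction.exists_smul_eq_smul_and_smul_eq_self (K := ℚ) cyclotomic_irreducible Nat.prime_seven
      (GaloisRep.cyclotomicCharacter_surjective ℚ 7 cyclotomic_irreducible unitEight).choose).choose_spec.1

/-- `σ₈` fixes every root of unity of order prime to `7`. [cite: Washington1997, Ch. 14 (p. 321)] -/
theorem σ₈_smul_eq_self {m : ℕ} (hm : (7 : ℕ).Coprime m) (ζ : AlgebraicClosure ℚ) (hζ : ζ ^ m = 1) : σ₈ • ζ = ζ :=
  (RootOfUnityAction.exists_smul_eq_smul_and_smul_eq_self (K := ℚ) cyclotomic_irreducible Nat.prime_seven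
    (GaloisRep.cyclotomicCharacter_surjective ℚ 7 cyclotomic_irreducible unitEight).choose).choose_spec.2 m hm ζ hζ

/-- **`γ₀ = σ₈²`** — field `γ₀` (l.127). [cite: Tsuji1999, §3 (p. 6, «γ a topological generator of Gal(K_∞/K)», «T = γ − 1»)] -/
def γ₀ : absoluteGaloisGroup ℚ := σ₈ ^ 2

/-- **`u = χ₇(γ₀)`** — field `u` (l.124); so `cyclotomicCharacter_γ₀` (l.128) holds by `rfl`. [cite: Tsuji1999, §3 (p. 6, «κ(γ₀) = u»)] -/
def u : ℤ_[7]ˣ := GaloisRep.cyclotomicCharacter ℚ 7 γ₀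

/-- The letter of field `cyclotomicCharacter_γ₀` (l.128). [cite: Tsuji1999, §3 (p. 6)] -/
theorem cyclotomicCharacter_γ₀ : GaloisRep.cyclotomicCharacter ℚ 7 γ₀ = u := rfl

/-- `u = 64 = 8²`. [cite: Lang1990, Ch. 10 §1 (PDF p. 167, «γ = 1 + p is a topological generator … any u ≡ 1 mod p, u ≢ 1 mod p²»)] -/
theorem coe_u : (u : ℤ_[7]) = 64 := by
  rw [u, γ₀, map_pow, cyclotomicCharacter_σ₈, Units.val_pow_eq_pow_val, coe_unitEight]; norm_num

/-- **`u = 64` is a topological generator of `1 + 7ℤ₇`** (`‖64 − 1‖ = ‖7·9‖ = 7⁻¹`) — the letter of field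
`u_topGenerator` (l.125). [cite: Lang1990, Ch. 10 §1 (PDF p. 167)] -/
theorem u_topGenerator : KubotaLeopoldt.IsTopGenerator 7 (u : ℤ_[7]) := by
  rw [KubotaLeopoldt.IsTopGenerator, coe_u, show (64 : ℤ_[7]) - 1 = 7 * 9 by norm_num, norm_mul]
  have h7 : ‖(7 : ℤ_[7])‖ = ((7 : ℕ) : ℝ)⁻¹ := by exact_mod_cast PadicInt.norm_p (p := 7)
  have h9 : ‖(9 : ℤ_[7])‖ = 1 := by
    refine le_antisymm (PadicInt.norm_le_one _) (not_lt.mp fun h => ?_)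
    have h' := (PadicInt.norm_int_lt_one_iff_dvd (p := 7) 9).mp (by exact_mod_cast h)
    revert h'; norm_num
  rw [h7, h9, mul_one]

/-- **`γ₀` fixes `K_0 = F₀(μ₇)` pointwise** — the letter of field `γ₀_mem` (l.129): `σ₈` fixes `μ_{|D|} ⊇` generators
of `F₀` (by `F₀_le`), and `γ₀` acts on `μ₇` by `64 ≡ 1 (mod 7)`. [cite: Tsuji1999, §3 (p. 6)] [cite: Washington1997, Ch. 14 (p. 321)] -/
theorem γ₀_mem (hD : D < 0) (hD4 : D % 4 = 1) (hsq : Squarefree D) (h7 : ¬ (7 : ℤ) ∣ D) :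
    γ₀ ∈ fixingSubgroupQ (cyclotomicLayer (F₀ D) 7 0) := by
  haveI : NeZero (7 : ℕ) := ⟨by norm_num⟩
  have hcop : (7 : ℕ).Coprime D.natAbs :=
    (Nat.Prime.coprime_iff_not_dvd Nat.prime_seven).mpr fun h => h7 (Int.ofNat_dvd_left.mpr h)
  rw [mem_fixingSubgroupQ_iff]
  intro x hx
  rw [← absoluteGaloisGroup.smul_def]
  have hS : ∀ ζ ∈ {x : AlgebraicClosure ℚ | x ^ D.natAbs = 1}, γ₀ • ζ = (1 : absoluteGaloisGroup ℚ) • ζ := by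
    intro ζ hζ
    rw [one_smul, γ₀, pow_two, mul_smul, σ₈_smul_eq_self hcop ζ hζ, σ₈_smul_eq_self hcop ζ hζ]
  have hT : ∀ ζ ∈ {x : AlgebraicClosure ℚ | x ^ 7 ^ (0 + 1) = 1}, γ₀ • ζ = (1 : absoluteGaloisGroup ℚ) • ζ := by
    intro ζ hζ
    rw [one_smul, GaloisRep.cyclotomicCharacter_spec ℚ 7 (k := 0 + 1) γ₀ ζ hζ, cyclotomicCharacter_γ₀, coe_u]
    have hval : ((PadicInt.toZModPow (0 + 1)) (64 : ℤ_[7])).val = 1 := by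
      rw [show (64 : ℤ_[7]) = ((64 : ℕ) : ℤ_[7]) by norm_cast, map_natCast, ZMod.val_natCast]; norm_num
    rw [hval, pow_one]
  have key := forall_smul_eq_of_le_sup_adjoin (σ := γ₀) (τ := 1) (F₀_le D hD hD4 hsq) hS hT x hx
  rwa [one_smul] at key

/-! ### `χD`, `χD_isPrimitive`, `χD_mul_self`, `χD_neg_one` (l.131–134): the Kronecker character, `ℤ₇`-valued -/

/-- **`χ_D = (· | |D|)`**, the Kronecker/Jacobi character mod `|D|` with values in `ℤ₇` (tree `jacobiCharInt`). Field `χD` (l.131). [cite: Cox2013, §1.C Lemma 1.14] -/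
def χD [NeZero D.natAbs] : DirichletCharacter ℤ_[7] D.natAbs :=
  (jacobiCharInt D.natAbs).ringHomComp (Int.castRingHom ℤ_[7])

/-- Values of `χD`. [cite: Cox2013, §1.C Lemma 1.14] -/
theorem χD_apply [NeZero D.natAbs] (a : ZMod D.natAbs) : χD D a = ((jacobiCharInt D.natAbs a : ℤ) : ℤ_[7]) := rfl

/-- **`χ_D` is primitive mod `|D|`** — the letter of field `χD_isPrimitive` (l.132) (tree `isPrimitive_jacobiChar` for odd
squarefree `|D|`, transported along the injections `ℤ → ℂ`, `ℤ → ℤ₇`). [cite: MontgomeryVaughan2007, Theorem 9.13] -/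
theorem χD_isPrimitive [NeZero D.natAbs] (hD4 : D % 4 = 1) (hsq : Squarefree D) : (χD D).IsPrimitive := by
  have hodd : Odd D.natAbs := by rw [Int.natAbs_odd]; exact Int.odd_iff.mpr (by omega)
  have h1 : (jacobiCharInt D.natAbs).IsPrimitive := by
    have h := isPrimitive_jacobiChar hodd (Int.squarefree_natAbs.mpr hsq)
    rw [← jacobiCharInt_ringHomComp] at h
    exact (Kato2004.LayerCharacterTwo.isPrimitive_ringHomComp_iff _ (Int.castRingHom ℂ).injective_int).mp h
  exact (Kato2004.LayerCharacterTwo.isPrimitive_ringHomComp_iff _ (Int.castRingHom ℤ_[7]).injective_int).mpr h1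

/-- **`χ_D² = 1`** — the letter of field `χD_mul_self` (l.133). [cite: Cox2013, §1.C Lemma 1.14] -/
theorem χD_mul_self [NeZero D.natAbs] : χD D * χD D = 1 := by
  rw [← pow_two]; exact (isQuadratic_jacobiCharInt.comp _).sq_eq_one

/-- **`χ_D(−1) = −1`** (`|D| ≡ 3 (mod 4)`) — the letter of field `χD_neg_one` (l.134). [cite: Cox2013, §1.C Lemma 1.14] -/
theorem χD_neg_one [NeZero D.natAbs] (hD : D < 0) (hD4 : D % 4 = 1) : χD D (-1) = -1 := by
  have hodd : Odd D.natAbs := by rw [Int.natAbs_odd]; exact Int.odd_iff.mpr (by omega)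
  rw [χD_apply, jacobiCharInt_neg_one hodd, ZMod.χ₄_nat_three_mod_four (by omega)]
  push_cast
  rfl

/-! ### `ω`, `ω_teichmuller` (l.136–137): the tree's Teichmüller character -/

/-- **`ω = Kato2004.teichmullerChar 7`** read as a Dirichlet character mod `7`. Field `ω` (l.136). [cite: Lang1990, Ch. 2 §2 Thm. 2.5] -/
def ω : DirichletCharacter ℤ_[7] 7 := MulChar.ofUnitHom (Kato2004.teichmullerChar 7)

/-- The letter of field `ω_teichmuller` (l.137) (tree `toZMod_ofUnitHom_teichmullerChar`). [cite: Lang1990, Ch. 2 §2 Thm. 2.5] -/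
theorem ω_teichmuller : IsTeichmullerCharacter 7 ω := fun a =>
  Literature.NumberTheory.Congruences.TeichmullerTwist.toZMod_ofUnitHom_teichmullerChar (p := 7) a

/-- `MulChar.ofUnitHom` commutes with powers. [cite: Lang1990, Ch. 1 §2] -/
theorem ofUnitHom_pow {R R' : Type*} [CommMonoid R] [CommMonoidWithZero R'] (f : Rˣ →* R'ˣ) (n : ℕ) :
    MulChar.ofUnitHom (f ^ n) = MulChar.ofUnitHom f ^ n := by
  refine MulChar.ext fun a => ?_
  simp only [MulChar.pow_apply_coe, MulChar.ofUnitHom_coe, MonoidHom.pow_apply, Units.val_pow_eq_pow_val]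

/-- `ω⁵ ≠ 1` (tree `ofUnitHom_teichmullerChar_pow_ne_one`). [cite: Lang1990, Ch. 2 §2] -/
theorem ω_pow_five_ne_one : ω ^ 5 ≠ 1 := by
  rw [ω, ← ofUnitHom_pow]
  exact Literature.NumberTheory.GaussSums.ofUnitHom_teichmullerChar_pow_ne_one 7 (by norm_num) (by norm_num)

/-- `ω⁵` is primitive mod `7` (prime level, non-trivial). [cite: Washington1997, Ch. 3 (conductors)] -/
theorem isPrimitive_ω_pow_five : (ω ^ 5).IsPrimitive := by
  rw [DirichletCharacter.isPrimitive_def]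
  rcases (Nat.dvd_prime Nat.prime_seven).mp (DirichletCharacter.conductor_dvd_level (ω ^ 5)) with h | h
  · exact absurd (DirichletCharacter.eq_one_iff_conductor_eq_one.mpr h) ω_pow_five_ne_one
  · exact h

/-! ### `etaOne_isPrimitive` (l.141–142): `η₁ = χ_D·ω⁵` mod `7|D|` is primitive -/

/-- **Characters with coprime conductors multiply to a PRIMITIVE character** (re-proved here from Mathlib's
`conductor_mul_dvd_lcm_conductor`, `conductor_inv`, `conductor_changeLevel`; the same lemma is proved in
`Theorems/EisensteinPrimesMazurMCOnCellBTwistbackTwistLineCharacters.lean`, which an `Additive/` file does not import). [cite: Washington1997, Ch. 3 (conductor of a product of characters of coprime conductors)] -/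
theorem isPrimitive_mul_of_coprime_levels {R : Type*} [CommMonoidWithZero R] {n₁ n₂ : ℕ} [NeZero n₁] [NeZero n₂]
    {χ₁ : DirichletCharacter R n₁} {χ₂ : DirichletCharacter R n₂} (h₁ : χ₁.IsPrimitive) (h₂ : χ₂.IsPrimitive)
    (hcop : n₁.Coprime n₂) :
    (DirichletCharacter.changeLevel (dvd_mul_right n₁ n₂) χ₁ *
      DirichletCharacter.changeLevel (dvd_mul_left n₂ n₁) χ₂ : DirichletCharacter R (n₁ * n₂)).IsPrimitive := by
  set χ : DirichletCharacter R (n₁ * n₂) := DirichletCharacter.changeLevel (dvd_mul_right n₁ n₂) χ₁ with hχ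
  set ψ : DirichletCharacter R (n₁ * n₂) := DirichletCharacter.changeLevel (dvd_mul_left n₂ n₁) χ₂ with hψ
  have hχc : χ.conductor = n₁ := by rw [hχ, DirichletCharacter.conductor_changeLevel]; exact h₁
  have hψc : ψ.conductor = n₂ := by rw [hψ, DirichletCharacter.conductor_changeLevel]; exact h₂
  have h : χ.conductor.Coprime ψ.conductor := by rw [hχc, hψc]; exact hcop
  rw [DirichletCharacter.isPrimitive_def]
  apply Nat.dvd_antisymm (DirichletCharacter.conductor_dvd_level _)
  have hχd : χ.conductor ∣ (χ * ψ).conductor := by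
    have h1 : χ = (χ * ψ) * ψ⁻¹ := by rw [mul_assoc, mul_inv_cancel, mul_one]
    have h2 := DirichletCharacter.conductor_mul_dvd_lcm_conductor (χ * ψ) ψ⁻¹
    rw [← h1, DirichletCharacter.conductor_inv] at h2
    exact h.dvd_of_dvd_mul_right (h2.trans (Nat.lcm_dvd_mul _ _))
  have hψd : ψ.conductor ∣ (χ * ψ).conductor := by
    have h1 : ψ = (χ * ψ) * χ⁻¹ := by rw [mul_comm χ ψ, mul_assoc, mul_inv_cancel, mul_one]
    have h2 := DirichletCharacter.conductor_mul_dvd_lcm_conductor (χ * ψ) χ⁻¹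
    rw [← h1, DirichletCharacter.conductor_inv] at h2
    exact h.symm.dvd_of_dvd_mul_right (h2.trans (Nat.lcm_dvd_mul _ _))
  have h3 := h.mul_dvd_of_dvd_of_dvd hχd hψd
  rwa [hχc, hψc] at h3

/-- **`η₁ = χ_D·ω⁵` read mod `|D|·7` is primitive** — the letter of field `etaOne_isPrimitive` (l.141–142). [cite: Lang1990, Ch. 10 §2 (PDF p. 171, «cond θ = dp»)] [cite: Washington1997, Ch. 3] -/
theorem etaOne_isPrimitive [NeZero D.natAbs] (hD4 : D % 4 = 1) (hsq : Squarefree D) (h7 : ¬ (7 : ℤ) ∣ D) :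
    (DirichletCharacter.changeLevel (Dvd.intro 7 rfl) (χD D) *
      (DirichletCharacter.changeLevel (Dvd.intro_left D.natAbs rfl) ω) ^ 5).IsPrimitive := by
  haveI : NeZero (7 : ℕ) := ⟨by norm_num⟩
  have hcop : D.natAbs.Coprime 7 :=
    ((Nat.Prime.coprime_iff_not_dvd Nat.prime_seven).mpr fun h => h7 (Int.ofNat_dvd_left.mpr h)).symm
  rw [← map_pow]
  exact isPrimitive_mul_of_coprime_levels (χD_isPrimitive D hD4 hsq) isPrimitive_ω_pow_five hcop

/-! ### `g`, `g_spec` (l.148–150): the `ℤ₇`-coefficient Kubota–Leopoldt series of `η₁` (under `hKL`) -/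

/-- Under `hKL`: a `ℤ₇`-coefficient Kubota–Leopoldt series for `(χ_D, i = 5, u)` exists (§A4 at `p = 7`). [cite: Tsuji1999, p. 6 and §4 Thm. 4.3] -/
theorem exists_g [NeZero D.natAbs] (hKL : iwasawa_existsUnique_kubotaLeopoldtSeries) (hD4 : D % 4 = 1)
    (hsq : Squarefree D) (h7 : ¬ (7 : ℤ) ∣ D) :
    ∃ g : IwasawaAlgebra 7, IsKubotaLeopoldtSeries 7 ((χD D).ringHomComp (KubotaLeopoldt.intAlgebraMap 7)) 5
      (u : ℤ_[7]) (PowerSeries.map (KubotaLeopoldt.intAlgebraMap 7) g) := by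
  have hcop : D.natAbs.Coprime 7 :=
    ((Nat.Prime.coprime_iff_not_dvd Nat.prime_seven).mpr fun h => h7 (Int.ofNat_dvd_left.mpr h)).symm
  exact exists_int_kubotaLeopoldtSeries hKL (by norm_num) hcop (χD_isPrimitive D hD4 hsq) (by norm_num)
    (by omega) u_topGenerator

/-- **`g = g_{η₁} ∈ Λ = ℤ₇⟦T⟧`** — field `g` (l.148), chosen from `exists_g`. [cite: Tsuji1999, §4 Definition p. 12] -/
def g [NeZero D.natAbs] (hKL : iwasawa_existsUnique_kubotaLeopoldtSeries) (hD4 : D % 4 = 1) (hsq : Squarefree D)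
    (h7 : ¬ (7 : ℤ) ∣ D) : IwasawaAlgebra 7 :=
  (exists_g D hKL hD4 hsq h7).choose

/-- The letter of field `g_spec` (l.149–150). [cite: Tsuji1999, §4 Thm. 4.3] -/
theorem g_spec [NeZero D.natAbs] (hKL : iwasawa_existsUnique_kubotaLeopoldtSeries) (hD4 : D % 4 = 1)
    (hsq : Squarefree D) (h7 : ¬ (7 : ℤ) ∣ D) :
    IsKubotaLeopoldtSeries 7 ((χD D).ringHomComp (KubotaLeopoldt.intAlgebraMap 7)) 5 (u : ℤ_[7])
      (PowerSeries.map (KubotaLeopoldt.intAlgebraMap 7) (g D hKL hD4 hsq h7)) :=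
  (exists_g D hKL hD4 hsq h7).choose_spec

/-! ### `r`, `r_logTable` (l.153–154): a `γ`-log table for `(u, ω)` (§A2 at `p = 7`) -/

/-- A `γ`-log table exists for `(u, ω)`. [cite: Lang1990, Ch. 10 §1 (PDF p. 167)] -/
theorem exists_r : ∃ r : ℕ → ℕ → ℕ, IsLogTable 7 (u : ℤ_[7]) ω r :=
  exists_isLogTable (by norm_num) u_topGenerator ω_teichmuller

/-- **The `γ`-log table** — field `r` (l.153). [cite: Lang1990, Ch. 10 §1 (PDF p. 167)] -/
def r : ℕ → ℕ → ℕ := exists_r.choose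

/-- The letter of field `r_logTable` (l.154). [cite: Lang1990, Ch. 10 §1 (PDF p. 167)] -/
theorem r_logTable : IsLogTable 7 (u : ℤ_[7]) ω r := exists_r.choose_spec

/-! ### `η₁`, `η₁_trivial`, `η₁_reading` (l.143–147): the genus character of `Υ = Gal(ℚ̄/B_∞)` through `ζsys 0` -/

/-- **`η₁ = χ_D·ω⁵` as a Dirichlet character mod `|D|·7`** (the character inside field `etaOne_isPrimitive`).
[cite: Tsuji1999, §4 (p. 12, «χ = φω^i»)] [cite: Lang1990, Ch. 10 §2 (PDF p. 171)] -/
def etaOne [NeZero D.natAbs] : DirichletCharacter ℤ_[7] (D.natAbs * 7) :=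
  DirichletCharacter.changeLevel (Dvd.intro 7 rfl) (χD D) *
    (DirichletCharacter.changeLevel (Dvd.intro_left D.natAbs rfl) ω) ^ 5

/-- `η₁` on units: `η₁(b) = χ_D(b mod |D|)·ω(b mod 7)⁵`. [cite: Tsuji1999, §4 (p. 12)] -/
theorem etaOne_apply_coe [NeZero D.natAbs] (b : (ZMod (D.natAbs * 7))ˣ) :
    etaOne D (b : ZMod (D.natAbs * 7)) =
      χD D (((b : ZMod (D.natAbs * 7))).val : ZMod D.natAbs) * (ω (((b : ZMod (D.natAbs * 7))).val : ZMod 7)) ^ 5 := by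
  haveI : NeZero (D.natAbs * 7) := ⟨mul_ne_zero (NeZero.ne _) (by norm_num)⟩
  rw [etaOne, MulChar.mul_apply, MulChar.pow_apply_coe, DirichletCharacter.changeLevel_eq_cast_of_dvd,
    DirichletCharacter.changeLevel_eq_cast_of_dvd, ZMod.cast_eq_val, ZMod.cast_eq_val]

/-- **The action of `Γ_ℚ` on `μ_{|D|·7}` read through `ζsys D 0`**: `σ ↦ a_σ ∈ (ℤ/|D|·7)^×` with `σ(ζ₀) = ζ₀^{a_σ}`
(Mathlib `IsPrimitiveRoot.autToPow` along `absoluteGaloisGroup.toAlgEquiv`). [cite: Washington1997, Thm. 2.5] -/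
def galToPow [NeZero D.natAbs] (h7 : ¬ (7 : ℤ) ∣ D) : absoluteGaloisGroup ℚ →* (ZMod (D.natAbs * 7))ˣ :=
  haveI : NeZero (D.natAbs * 7) := ⟨mul_ne_zero (NeZero.ne _) (by norm_num)⟩
  ((isPrimitiveRoot_ζsys_zero D h7).autToPow ℚ).comp (absoluteGaloisGroup.toAlgEquiv ℚ).toMonoidHom

/-- Defining property of `galToPow`. [cite: Washington1997, Thm. 2.5] -/
theorem ζsys_zero_pow_galToPow [NeZero D.natAbs] (h7 : ¬ (7 : ℤ) ∣ D) (σ : absoluteGaloisGroup ℚ) :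
    ζsys D 0 ^ ((galToPow D h7 σ : (ZMod (D.natAbs * 7))ˣ) : ZMod (D.natAbs * 7)).val =
      absoluteGaloisGroup.toAlgEquiv ℚ σ (ζsys D 0) := by
  haveI : NeZero (D.natAbs * 7) := ⟨mul_ne_zero (NeZero.ne _) (by norm_num)⟩
  exact (isPrimitiveRoot_ζsys_zero D h7).autToPow_spec ℚ _

/-- If `σ(ζ₀) = ζ₀^a` then `a_σ = a` in `ℤ/|D|·7`. [cite: Washington1997, Thm. 2.5] -/
theorem galToPow_eq_natCast [NeZero D.natAbs] (h7 : ¬ (7 : ℤ) ∣ D) {σ : absoluteGaloisGroup ℚ} {a : ℕ}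
    (ha : absoluteGaloisGroup.toAlgEquiv ℚ σ (ζsys D 0) = ζsys D 0 ^ a) :
    ((galToPow D h7 σ : (ZMod (D.natAbs * 7))ˣ) : ZMod (D.natAbs * 7)) = (a : ZMod (D.natAbs * 7)) := by
  haveI : NeZero (D.natAbs * 7) := ⟨mul_ne_zero (NeZero.ne _) (by norm_num)⟩
  have hζ := isPrimitiveRoot_ζsys_zero D h7
  have hpos : 0 < D.natAbs * 7 := Nat.pos_of_ne_zero (NeZero.ne _)
  have h1 : ζsys D 0 ^ ((galToPow D h7 σ : (ZMod (D.natAbs * 7))ˣ) : ZMod (D.natAbs * 7)).val =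
      ζsys D 0 ^ (a % (D.natAbs * 7)) := by
    rw [ζsys_zero_pow_galToPow, ha]
    exact pow_eq_pow_mod a hζ.pow_eq_one
  have h2 := hζ.pow_inj (ZMod.val_lt _) (Nat.mod_lt a hpos) h1
  rw [← ZMod.natCast_zmod_val ((galToPow D h7 σ : (ZMod (D.natAbs * 7))ˣ) : ZMod (D.natAbs * 7)), h2,
    ZMod.natCast_mod]

/-- **The genus character `η₁ : Υ → ℤ₇^×`**, `η₁(σ) = (χ_D ω⁵)(a_σ)` — field `η₁` (l.143). [cite: Tsuji1999, §3 (p. 6) and §4 (p. 12)] -/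
def η₁ [NeZero D.natAbs] (h7 : ¬ (7 : ℤ) ∣ D) : torsionCyclotomicSubgroup 7 →* ℤ_[7]ˣ :=
  ((MulChar.toUnitHom (etaOne D)).comp (galToPow D h7)).comp (torsionCyclotomicSubgroup 7).subtype

/-- Unfolding `η₁`. [cite: Tsuji1999, §4 (p. 12)] -/
theorem coe_η₁_apply [NeZero D.natAbs] (h7 : ¬ (7 : ℤ) ∣ D) (σ : torsionCyclotomicSubgroup 7) :
    ((η₁ D h7 σ : ℤ_[7]ˣ) : ℤ_[7]) =
      etaOne D ((galToPow D h7 (σ : absoluteGaloisGroup ℚ) : (ZMod (D.natAbs * 7))ˣ) : ZMod (D.natAbs * 7)) :=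
  rfl

/-- **`η₁` READS AS `χ_D·ω⁵` through `ζsys 0`** — the letter of field `η₁_reading` (l.147). [cite: Tsuji1999, §4 (p. 12, L14–19) and §5 (p. 14, L30–33)] -/
theorem η₁_reading [NeZero D.natAbs] (h7 : ¬ (7 : ℤ) ∣ D) :
    IsDirichletReading 7 (torsionCyclotomicSubgroup 7) (η₁ D h7) (ζsys D 0) (χD D) ω 5 := by
  intro σ a ha
  haveI : NeZero (D.natAbs * 7) := ⟨mul_ne_zero (NeZero.ne _) (by norm_num)⟩
  have hg : ((galToPow D h7 (σ : absoluteGaloisGroup ℚ) : (ZMod (D.natAbs * 7))ˣ) : ZMod (D.natAbs * 7)).val =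
      a % (D.natAbs * 7) := by
    rw [galToPow_eq_natCast D h7 ha, ZMod.val_natCast]
  have hD' : ((a % (D.natAbs * 7) : ℕ) : ZMod D.natAbs) = (a : ZMod D.natAbs) := by
    rw [ZMod.natCast_eq_natCast_iff', Nat.mod_mul_right_mod]
  have h7' : ((a % (D.natAbs * 7) : ℕ) : ZMod 7) = (a : ZMod 7) := by
    rw [ZMod.natCast_eq_natCast_iff', Nat.mod_mul_left_mod]
  rw [coe_η₁_apply, etaOne_apply_coe, hg, hD', h7']

/-- **`η₁` IS TRIVIAL ON `Gal(ℚ̄/K_∞)`** — the letter of field `η₁_trivial` (l.144–145): an element of `Υ` fixing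
`K_0 = F₀(μ₇)` fixes `μ₇` (so `a_σ ≡ 1 (mod 7)`, `ω⁵(a_σ) = 1`) and fixes the Gauss square root `G = √D ∈ F₀`
(§A5: `σ G = (a_σ | |D|)·G`, `G ≠ 0`, so `χ_D(a_σ) = (a_σ | |D|) = 1`). [cite: Tsuji1999, §3 (p. 6, L1–5)] [cite: Washington1997, Ch. 4 Lemma 4.8] -/
theorem η₁_trivial [NeZero D.natAbs] (hD : D < 0) (hD4 : D % 4 = 1) (hsq : Squarefree D) (h7 : ¬ (7 : ℤ) ∣ D) :
    ∀ σ : torsionCyclotomicSubgroup 7,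
      (∀ n, (σ : absoluteGaloisGroup ℚ) ∈ fixingSubgroupQ (cyclotomicLayer (F₀ D) 7 n)) → η₁ D h7 σ = 1 := by
  intro σ hσ
  haveI : NeZero (7 : ℕ) := ⟨by norm_num⟩
  haveI : NeZero (D.natAbs * 7) := ⟨mul_ne_zero (NeZero.ne _) (by norm_num)⟩
  have hodd : Odd D.natAbs := by rw [Int.natAbs_odd]; exact Int.odd_iff.mpr (by omega)
  have hsq' : Squarefree D.natAbs := Int.squarefree_natAbs.mpr hsq
  have h3 : D.natAbs % 4 = 3 := by omega
  have hpos : 0 < D.natAbs * 7 := Nat.pos_of_ne_zero (NeZero.ne _)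
  have hfix := (mem_fixingSubgroupQ_iff _ _).mp (hσ 0)
  have hζ := isPrimitiveRoot_ζsys_zero D h7
  -- the exponent `b = a_σ`
  obtain ⟨b, hb⟩ : ∃ b : ℕ,
      ((galToPow D h7 (σ : absoluteGaloisGroup ℚ) : (ZMod (D.natAbs * 7))ˣ) : ZMod (D.natAbs * 7)).val = b :=
    ⟨_, rfl⟩
  have hσζ : (σ : absoluteGaloisGroup ℚ) • ζsys D 0 = ζsys D 0 ^ b := by
    rw [absoluteGaloisGroup.smul_def, ← ζsys_zero_pow_galToPow D h7, hb]
  have hpow : ∀ k : ℕ, k ∣ D.natAbs * 7 → ∀ ζ : AlgebraicClosure ℚ, ζ ^ k = 1 →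
      (σ : absoluteGaloisGroup ℚ) • ζ = ζ ^ b :=
    fun k hk ζ hζk => GenusFrame.smul_eq_pow_of_smul_primitiveRoot hζ hσζ hk ζ hζk
  -- (ω-part) `σ` fixes `μ₇ ⊆ K_0`, so `b ≡ 1 (mod 7)`
  have h7part : (b : ZMod 7) = 1 := by
    have hζ7 : IsPrimitiveRoot (ζsys D 0 ^ D.natAbs) 7 := IsPrimitiveRoot.pow hpos hζ rfl
    have hmem : ζsys D 0 ^ D.natAbs ∈ cyclotomicLayer (F₀ D) 7 0 :=
      mem_cyclotomicLayer_of_pow_eq_one (F₀ D) 7 0 (by rw [zero_add, pow_one]; exact hζ7.pow_eq_one)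
    have hfix7 : (σ : absoluteGaloisGroup ℚ) • (ζsys D 0 ^ D.natAbs) = ζsys D 0 ^ D.natAbs := by
      rw [absoluteGaloisGroup.smul_def]; exact hfix _ hmem
    have hb7 : (ζsys D 0 ^ D.natAbs) ^ (b % 7) = (ζsys D 0 ^ D.natAbs) ^ (1 % 7) := by
      rw [← pow_eq_pow_mod b hζ7.pow_eq_one, ← pow_eq_pow_mod 1 hζ7.pow_eq_one, pow_one,
        ← hpow 7 (dvd_mul_left 7 _) _ hζ7.pow_eq_one, hfix7]
    have hmod := hζ7.pow_inj (Nat.mod_lt b (by norm_num)) (Nat.mod_lt 1 (by norm_num)) hb7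
    have := (ZMod.natCast_eq_natCast_iff' b 1 7).mpr hmod
    rwa [Nat.cast_one] at this
  -- (χ_D-part) `σ` fixes the Gauss square root `G = √D ∈ F₀ ≤ K_0`, so `(b | |D|) = 1`
  have hDpart : χD D (b : ZMod D.natAbs) = 1 := by
    obtain ⟨G, -, hGsq, hG0, hGal⟩ := exists_gaussSqrt hodd hsq'
    have hcast : ((D.natAbs : ℕ) : AlgebraicClosure ℚ) = -(D : AlgebraicClosure ℚ) := by
      have : ((D.natAbs : ℕ) : ℤ) = -D := by omega
      rw [← Int.cast_natCast, this, Int.cast_neg]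
    have hG2 : G ^ 2 = (D : AlgebraicClosure ℚ) := by
      rw [hGsq, ZMod.χ₄_nat_three_mod_four h3, hcast]; push_cast; ring
    have hGF : G ∈ F₀ D := IntermediateField.subset_adjoin ℚ _ (by exact hG2)
    have hσG : absoluteGaloisGroup.toAlgEquiv ℚ (σ : absoluteGaloisGroup ℚ) G = G :=
      hfix G (le_cyclotomicLayer (F₀ D) 7 0 hGF)
    -- (`hGal` quantifies over `ℚ̄ ≃ₐ[ℚ] ℚ̄` at Mathlib's `DivisionRing.toRatAlgebra`; `toAlgEquiv` lands at
    -- `AlgebraicClosure.instAlgebra` — the two agree definitionally, so we pass between them by `exact`, not `rw`)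
    have hGal' := hGal (absoluteGaloisGroup.toAlgEquiv ℚ (σ : absoluteGaloisGroup ℚ)) b fun ζ hζD => by
      have h := hpow D.natAbs (dvd_mul_right _ _) ζ hζD
      rw [absoluteGaloisGroup.smul_def] at h
      exact h
    have hJG : (jacobiSym b D.natAbs : AlgebraicClosure ℚ) * G = 1 * G := by
      rw [one_mul]; exact hGal'.symm.trans hσG
    have hJ : (jacobiSym b D.natAbs : AlgebraicClosure ℚ) = 1 := mul_right_cancel₀ hG0 hJG
    have hJ1 : jacobiSym b D.natAbs = 1 := by
      rcases jacobiSym.trichotomy b D.natAbs with h | h | h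
      · rw [h, Int.cast_zero] at hJ; exact absurd hJ zero_ne_one
      · exact h
      · rw [h, Int.cast_neg, Int.cast_one] at hJ; norm_num at hJ
    rw [χD_apply, jacobiCharInt_natCast, hJ1, Int.cast_one]
  -- assemble
  ext
  rw [Units.val_one, coe_η₁_apply, etaOne_apply_coe, hb, hDpart, h7part, map_one, one_pow, mul_one]

/-! ### Assembly check (letter discipline, mechanical) -/

/-- **ASSEMBLY CHECK — the §B declarations populate EVERY field of `GenusSeven.GenusFrame` in its exact letter**, except
the road parameters (`D` with its four hypotheses, `normA` with its two) and the semi-local datum `U` (row K2C-13 ★),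
which are taken as ARGUMENTS; `hKL` is the displayed named fact (for `g`).  This is NOT `genusFrameOf` of the later file
(6) (that one will also PRODUCE `U` and `normA`); it is the kernel's certificate that nothing in l.113–154 is left open.
[cite: Tsuji1999, §3 Thm 3.1 (p. 6) — the binders] [cite: Kato2004Asterisque, §15.5 (p. 253)] -/
def mkGenusFrame (hD : D < 0) (hD4 : D % 4 = 1) (hsq : Squarefree D) (h7 : ¬ (7 : ℤ) ∣ D) (N : ℕ) (hN : 2 ≤ N)
    (hNc : N.Coprime (7 * D.natAbs)) (hKL : iwasawa_existsUnique_kubotaLeopoldtSeries)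
    (U : CyclotomicSemilocalUnitData 7 placeSeven (cyclotomicLayer (F₀ D) 7) (cyclotomicLayer_monotone (F₀ D) 7)
      (torsionCyclotomicSubgroup 7) γ₀) : GenusFrame :=
  haveI : NeZero D.natAbs := ⟨Int.natAbs_ne_zero.mpr hD.ne⟩
  { D := D, D_neg := hD, D_mod_four := hD4, D_squarefree := hsq, not_seven_dvd_D := h7, normA := N, two_le_normA := hN,
    normA_coprime := hNc, v := placeSeven, seven_mem_v := seven_mem_placeSeven, F₀ := F₀ D, F₀_eq := F₀_eq D,
    F₀_le := F₀_le D hD hD4 hsq, ζsys := ζsys D, ζsys_compatible := ζsys_compatible D h7, u := u,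
    u_topGenerator := u_topGenerator, γ₀ := γ₀, cyclotomicCharacter_γ₀ := cyclotomicCharacter_γ₀,
    γ₀_mem := γ₀_mem D hD hD4 hsq h7, χD := χD D, χD_isPrimitive := χD_isPrimitive D hD4 hsq, χD_mul_self := χD_mul_self D,
    χD_neg_one := χD_neg_one D hD hD4, ω := ω, ω_teichmuller := ω_teichmuller,
    etaOne_isPrimitive := etaOne_isPrimitive D hD4 hsq h7, η₁ := η₁ D h7, η₁_trivial := η₁_trivial D hD hD4 hsq h7,
    η₁_reading := η₁_reading D h7, g := g D hKL hD4 hsq h7, g_spec := g_spec D hKL hD4 hsq h7, r := r,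
    r_logTable := r_logTable, U := U }

/-- The assembled frame has the given discriminant. [cite: Tsuji1999, §3 (p. 5)] -/
theorem mkGenusFrame_D (hD : D < 0) (hD4 : D % 4 = 1) (hsq : Squarefree D) (h7 : ¬ (7 : ℤ) ∣ D) (N : ℕ) (hN : 2 ≤ N)
    (hNc : N.Coprime (7 * D.natAbs)) (hKL : iwasawa_existsUnique_kubotaLeopoldtSeries)
    (U : CyclotomicSemilocalUnitData 7 placeSeven (cyclotomicLayer (F₀ D) 7) (cyclotomicLayer_monotone (F₀ D) 7)
      (torsionCyclotomicSubgroup 7) γ₀) :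
    (mkGenusFrame D hD hD4 hsq h7 N hN hNc hKL U).D = D := rfl

end Frame


end Summit.BirchSwinnertonDyer.BirchSwinnertonDyer.Cruxes.EllipticUnitValueSevenOfGZK.K2C14

end
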